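import Summits.KontsevichZagierPeriods.KontsevichZagierPeriods.Theorems.LinRedNormalFormArrangementNormalFormStubRebaseSimpleZeroManyChainRadial
import Summits.KontsevichZagierPeriods.KontsevichZagierPeriods.Theorems.LinRedNormalFormArrangementNormalFormStubRebaseSimpleZeroManyChainPerm

/-!
# Stub `stub_rebaseSimpleZeroMany`, part `rebaseSimpleZeroMany_common` (crux `ArrangementNormalForm`,
line `janus-bands`) — brick `ChainNarrow`

**Narrowing the mixed pinch configurations.** By the radial blow-up (`IsChain.good_radial`,
brick `ChainRadial`) a mixed pinch configuration (`RebaseChain.mixedSet n`, brick `ChainPinch`)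
all of whose fibres are lettered and which has exactly one letter off the vertex level is good
for `GG 0 2 (n + 1)`. What resists is `RebaseChain.mixedSet' n`: the mixed configurations with a
vertex letter and EITHER a letter-free fibre together with a letter off the vertex OR two
letters off the vertex (both need `n + 1 ≥ 3` fibres; members
`[{0<y<1, y<t₀<t₁<t₂<2y}, 1/(y t₀ (t₂ − 7))]`, `[{0<y<1, y<t₀<t₁<t₂<2y}, 1/(y t₀ (t₁ − 7)(t₂ − 9))]`).
Hence (`RebaseChain.goodN_of_goodM`) everything good modulo `mixedSet n` is good modulo
`mixedSet' n`, and the clean-chain / permuted-chain theorems hold with the narrower exceptional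
set (`rebaseSimpleZeroMany_cleanChainNarrow`, registered, and `RebaseChain.goodN_permChain`);
for two fibres `mixedSet' 1` is empty by pigeonhole (`RebaseChain.mixedSet'_one_eq`), so the
pair case is recovered unconditionally (`RebaseChain.good_cleanChain_two`).

References: M. Kontsevich, D. Zagier, *Periods* (2001), §1.2, rules (1), (2).
-/

noncomputable section

open Set MeasureTheory MvPolynomial
open Literature.NumberTheory.Transcendental Literature.ModelTheory.ExponentialFields

namespace Summit.KontsevichZagierPeriods.ArrangementNormalForm.JanusBands

namespace RebaseChain

open SeparatePos RebasePos RebaseZero RebaseNest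

variable {n : ℕ}

/-- **The resisting mixed pinch configurations**: as `mixedSet n` (two-row cell, bounds through
the vertex opening strictly upwards, base pole at the pinch abscissa, a letter at the vertex
level), with moreover a letter-free fibre AND a letter off the vertex, or TWO letters off the
vertex. [Kontsevich–Zagier 2001, §1.2] -/
def mixedSet' (n : ℕ) : Set KZ.FormalRep :=
  {w | ∃ (s : KZ.IntegralRep (0 + 1 + (n + 1))) (A Bd : Cf) (T : BData) (p : MvPolynomial (Fin 0) ℚ)
    (a : Fin (n + 1) → Option Cf) (y₀ t₀ ε₁ ε : ℚ),
    IsChain s ![RebaseZero.mk ε₁ (-(ε₁ * y₀)), RebaseZero.mk (-ε₁) (ε₁ * y₀ + ε)] A Bd T p a ∧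
    (ε₁ = 1 ∨ ε₁ = -1) ∧ 0 < ε ∧ A.1 (Fin.last 0) * y₀ + A.2 = t₀ ∧ Bd.1 (Fin.last 0) * y₀ + Bd.2 = t₀ ∧
    0 < ε₁ * A.1 (Fin.last 0) ∧ ε₁ * A.1 (Fin.last 0) < ε₁ * Bd.1 (Fin.last 0) ∧ T.ℓ₂.2 = y₀ ∧
    (∃ l c, a l = some c ∧ c.2 = t₀) ∧
    ((∃ l, a l = none) ∧ (∃ l c, a l = some c ∧ c.2 ≠ t₀) ∨
      ∃ l l' c c', l ≠ l' ∧ a l = some c ∧ c.2 ≠ t₀ ∧ a l' = some c' ∧ c'.2 ≠ t₀) ∧ w = KZ.of s}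

/-- `GOOD MODULO THE RESISTING CONFIGURATIONS`: congruent modulo `KZ.relations` to the subgroup
generated by `GG 0 2 (n + 1)` and `mixedSet' n`. [folklore] -/
def GoodN (n : ℕ) (x : KZ.FormalRep) : Prop :=
  ∃ c ∈ AddSubgroup.closure (GGset 0 2 (n + 1) ∪ mixedSet' n), x - c ∈ KZ.relations

/-- Good elements are good modulo the resisting configurations. [folklore] -/
theorem goodN_of_good {x : KZ.FormalRep} (h : Good (n + 1) x) : GoodN n x := by
  obtain ⟨c, hc, hxc⟩ := h
  exact ⟨c, AddSubgroup.closure_mono subset_union_left hc, hxc⟩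

/-- **Narrowing.** Every mixed pinch configuration is good modulo the resisting ones: if all
fibres are lettered and only one letter is off the vertex, the radial blow-up applies. -/
theorem goodN_of_mem_mixedSet {x : KZ.FormalRep} (hx : x ∈ mixedSet n) : GoodN n x := by
  obtain ⟨s, A, Bd, T, p, a, y₀, t₀, ε₁, ε, hN, hε₁, hε, hA0, hB0, hα, hαβ, hp, hat, ⟨l₂, c₂, hc₂, hne⟩, rfl⟩ := hx
  by_cases hfree : ∃ l, a l = none
  · exact RebaseNest.good_of_mem (Or.inr ⟨s, A, Bd, T, p, a, y₀, t₀, ε₁, ε, hN, hε₁, hε, hA0, hB0, hα, hαβ, hp,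
      hat, Or.inl ⟨hfree, l₂, c₂, hc₂, hne⟩, rfl⟩)
  by_cases htwo : ∃ l c, l ≠ l₂ ∧ a l = some c ∧ c.2 ≠ t₀
  · obtain ⟨l₃, c₃, hl₃, hc₃, hne₃⟩ := htwo
    exact RebaseNest.good_of_mem (Or.inr ⟨s, A, Bd, T, p, a, y₀, t₀, ε₁, ε, hN, hε₁, hε, hA0, hB0, hα, hαβ, hp,
      hat, Or.inr ⟨l₃, l₂, c₃, c₂, hl₃, hc₃, hne₃, hc₂, hne⟩, rfl⟩)
  -- all fibres lettered, the only letter off the vertex sits on `l₂`: radial blow-up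
  push Not at hfree htwo
  refine goodN_of_good (hN.good_radial l₂ y₀ t₀ ε₁ ε hε₁ hε (fun y => mem_cell_two y₀ ε ε₁ y) hA0 hB0 hα hp
    hc₂ fun l hl => ?_)
  rcases hal : a l with _ | c
  · exact absurd hal (hfree l)
  · exact ⟨c, rfl, htwo l c hl hal⟩

/-- Under narrowing the enlarged subgroup consists of elements good modulo the resisting
configurations. -/
theorem goodN_of_mem_closure {c : KZ.FormalRep} (hc : c ∈ AddSubgroup.closure (GGset 0 2 (n + 1) ∪ mixedSet n)) :
    GoodN n c := by
  induction hc using AddSubgroup.closure_induction with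
  | mem y hy =>
    rcases hy with hy | hy
    · exact goodN_of_good (RebaseZero.good_of_mem hy)
    · exact goodN_of_mem_mixedSet hy
  | zero => exact RebaseNest.good_of_mem_relations (zero_mem _)
  | add x y _ _ hx hy => exact RebaseNest.good_add hx hy
  | neg x _ hx =>
    obtain ⟨c, hc, hxc⟩ := hx
    refine ⟨-c, neg_mem hc, ?_⟩
    have := KZ.relations.neg_mem hxc
    rwa [show -(x - c) = -x - -c by abel] at this

/-- **`GoodM` implies `GoodN`**: the exceptional set shrinks from `mixedSet n` to `mixedSet' n`. -/
theorem goodN_of_goodM {x : KZ.FormalRep} (h : GoodM n x) : GoodN n x := by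
  obtain ⟨c, hc, hxc⟩ := h
  exact RebaseNest.good_of_sub_mem hxc (goodN_of_mem_closure hc)

/-- **Chains in any order of the fibre indices, narrow exceptional set.** -/
theorem goodN_permChain (σ : Equiv.Perm (Fin (n + 1))) {m m' n₁ n₂ : ℕ} (s : KZ.IntegralRep (0 + 1 + (n + 1)))
    (M : Fin m' → Cf) (L : Fin m → (Fin 0 → ℚ) × ℚ) (e : Fin m → ℕ) (p : MvPolynomial (Fin 0) ℚ)
    (ℓ₁ ℓ₂ : (Fin 0 → ℚ) × ℚ) (a : Fin (n + 1) → Option Cf) (A Bd : Cf) (h1 : n₁ = 0) (hn : n₂ = 1)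
    (hbd : Bornology.IsBounded s.domain) (hdom : s.domain = gDom 0 (n + 1) m' M (plo σ A) (phi σ Bd))
    (hint : EqOn s.integrand (glit 0 (n + 1) p L e ℓ₁ ℓ₂ n₁ n₂ a) s.domain)
    (lam : ℚ) (ha : ∀ l c, a l = some c → c.1 (Fin.last 0) = lam) : GoodN n (KZ.of s) :=
  goodN_of_goodM (goodM_permChain σ s M L e p ℓ₁ ℓ₂ a A Bd h1 hn hbd hdom hint lam ha)

/-- **Two fibres: the resisting set is empty.** With `n + 1 = 2` fibres one of the two carries
the vertex letter, so neither "a free fibre and an off-vertex letter" nor "two off-vertex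
letters" can occur. -/
theorem mixedSet'_one_eq : mixedSet' 1 = ∅ := by
  refine Set.eq_empty_of_forall_notMem fun w hw => ?_
  obtain ⟨s, A, Bd, T, p, a, y₀, t₀, ε₁, ε, -, -, -, -, -, -, -, -, ⟨l₁, c₁, hc₁, hct⟩, hres, -⟩ := hw
  have key : ∀ l l' : Fin (1 + 1), l ≠ l₁ → l' ≠ l₁ → l = l' := fun l l' hl hl' => by
    omega
  rcases hres with ⟨⟨l, hl⟩, l', c', hc', hne'⟩ | ⟨l, l', c, c', hll', hc, hne, hc', hne'⟩
  · have h1 : l ≠ l₁ := fun h => by rw [h, hc₁] at hl; cases hl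
    have h2 : l' ≠ l₁ := fun h => by rw [h, hc₁] at hc'; cases hc'; exact hne' hct
    rw [key l l' h1 h2, hc'] at hl; cases hl
  · have h1 : l ≠ l₁ := fun h => by rw [h, hc₁] at hc; cases hc; exact hne hct
    have h2 : l' ≠ l₁ := fun h => by rw [h, hc₁] at hc'; cases hc'; exact hne' hct
    exact hll' (key l l' h1 h2)

/-- Two fibres: good modulo the (empty) resisting set is good. -/
theorem good_of_goodN_one {x : KZ.FormalRep} (h : GoodN 1 x) : Good (1 + 1) x := by
  obtain ⟨c, hc, hxc⟩ := h
  rw [mixedSet'_one_eq, Set.union_empty] at hc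
  exact ⟨c, hc, hxc⟩

/-- **Two fibres, unconditionally** (an independent re-derivation of the pair case of workers
W3/W4 inside the chain machinery): a clean nested pair `A < t₀ < t₁ < B` with letters of a common
`y`-slope over a one-dimensional base (literal `GS 0 2` datum) is good for `GG 0 2 2`. -/
theorem good_cleanChain_two {m m' n₁ n₂ : ℕ} (s : KZ.IntegralRep (0 + 1 + (1 + 1)))
    (M : Fin m' → Cf) (L : Fin m → (Fin 0 → ℚ) × ℚ) (e : Fin m → ℕ) (p : MvPolynomial (Fin 0) ℚ)
    (ℓ₁ ℓ₂ : (Fin 0 → ℚ) × ℚ) (a : Fin (1 + 1) → Option Cf) (A Bd : Cf) (h1 : n₁ = 0) (hn : n₂ = 1)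
    (hbd : Bornology.IsBounded s.domain) (hdom : s.domain = gDom 0 (1 + 1) m' M (clo A) (chi Bd))
    (hint : EqOn s.integrand (glit 0 (1 + 1) p L e ℓ₁ ℓ₂ n₁ n₂ a) s.domain)
    (lam : ℚ) (ha : ∀ l c, a l = some c → c.1 (Fin.last 0) = lam) : Good (1 + 1) (KZ.of s) :=
  good_of_goodN_one (goodN_of_goodM (goodM_cleanChain s M L e p ℓ₁ ℓ₂ a A Bd h1 hn hbd hdom hint lam ha))

end RebaseChain

/-- Registered support goal of this file (part of `rebaseSimpleZeroMany_common`), UNCONDITIONAL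
with the NARROW exceptional set: clean chains `A < t₀ < ⋯ < tₙ < B` of `n + 1` fibres with
letters of a common `y`-slope over a one-dimensional base (literal `GS 0 (n + 1)` datum) are
congruent modulo `KZ.relations` to the subgroup generated by `GG 0 2 (n + 1)` and the resisting
mixed pinch configurations `RebaseChain.mixedSet' n` (a vertex letter plus: a letter-free fibre
and a letter off the vertex, or two letters off the vertex). -/
theorem rebaseSimpleZeroMany_cleanChainNarrow (n m m' n₁ n₂ : ℕ) (s : KZ.IntegralRep (0 + 1 + (n + 1))) (M : Fin m' → (Fin (0 + 1) → ℚ) × ℚ) (L : Fin m → (Fin 0 → ℚ) × ℚ) (e : Fin m → ℕ) (p : MvPolynomial (Fin 0) ℚ) (ℓ₁ ℓ₂ : (Fin 0 → ℚ) × ℚ) (a : Fin (n + 1) → Option ((Fin (0 + 1) → ℚ) × ℚ)) (A Bd : (Fin (0 + 1) → ℚ) × ℚ) (h1 : n₁ = 0) (hn : n₂ = 1) (hbd : Bornology.IsBounded s.domain) (hdom : s.domain = SeparatePos.gDom 0 (n + 1) m' M (RebaseChain.clo A) (RebaseChain.chi Bd)) (hint : EqOn s.integrand (RebasePos.glit 0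 (n + 1) p L e ℓ₁ ℓ₂ n₁ n₂ a) s.domain) (lam : ℚ) (ha : ∀ l c, a l = some c → c.1 (Fin.last 0) = lam) : ∃ c ∈ AddSubgroup.closure (SeparatePos.GGset 0 2 (n + 1) ∪ RebaseChain.mixedSet' n), KZ.of s - c ∈ KZ.relations :=
  RebaseChain.goodN_of_goodM (RebaseChain.goodM_cleanChain s M L e p ℓ₁ ℓ₂ a A Bd h1 hn hbd hdom hint lam ha)

end Summit.KontsevichZagierPeriods.ArrangementNormalForm.JanusBands
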